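import Literature.RingTheory.FormalGroups.FormalOModuleBudCongr
import HarnessLib

/-!
# Buds of formal `𝒪`-module laws, IX: linearisation over an `𝒪`-algebra in which `ϖ` is invertible
# ([Drinfeld 1974] §1 (proof of Prop. 1.2: `Λ_𝒪 ⊗ K = K[…]`); [Lazard 1955] §II; [Hazewinkel 1978] §21.5)

Topic `Literature/RingTheory/FormalGroups`; namespace `Literature.RingTheory.FormalGroups`.  Fully proved theorems; no
definition, no named fact, no instance, no notation, no `sorry`.  Cell `hodgecm-mathlib`, P6 «MOD programme», sub-line P6d
(power-series layer for `stub_L4B3cO`).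

Let `R` be an `𝒪`-algebra, `c = ϖ·1_R` with `c^i − c ∈ R×` for all `i ≥ 2` (e.g. `R ⊇ K = Frac 𝒪`, `ϖ` a uniformiser), and
`(f, r)` a `k`-bud over `R` (`k ≥ 1`).  The endomorphism `r_ϖ ≡ c·X` can be LINEARISED degree by degree:
* `IsOModuleBud.exists_linearizer` — a strict series `h` (`h ≡ X mod deg 2`) with `h(r_ϖ(X)) ≡ c·h(X) (mod deg k+1)`;
* `le_order_of_smul_sub_subst` — the bootstrap: a series `G ≡ 0 (mod deg 2)` with `c·G ≡ G(w) (mod deg k+1)` for arguments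
  `w_s ≡ c·X_s (mod deg 2)` vanishes `mod deg k+1` (compare degree-`i` parts: `(c^i − c)·G_i = 0`);
* `IsOModuleBud.le_order_linearizer_law` — then `h(f(X₀,X₁)) ≡ h(X₀) + h(X₁)` and
  `IsOModuleBud.le_order_linearizer_act` — `h(r_a(X)) ≡ a·h(X) (mod deg k+1)` for all `a`:
  modulo degree `k + 1`, `h` conjugates the bud into the ADDITIVE formal `𝒪`-module.
The sibling `FormalOModuleBudExtension` transports the additive law back along `h` to EXTEND the bud.
-/

noncomputable section

namespace Literature.RingTheory.FormalGroups

open MvPowerSeries (HasSubst subst X order coeff rescale)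
open Finset Finsupp

universe u v

variable {𝒪 : Type u} [CommRing 𝒪] {R : Type v} [CommRing R] [Algebra 𝒪 R]

/-! ## §1 The bootstrap -/

/-- `G(c·X) = rescale c G` has degree-`d` coefficient `c^{|d|}·[X^d]G`. [folklore] -/
private theorem coeff_subst_smul_X {σ : Type*} [Fintype σ] (c : R) (G : MvPowerSeries σ R) (d : σ →₀ ℕ) :
    coeff d (G.subst (fun s => c • (X s : MvPowerSeries σ R))) = c ^ d.degree * coeff d G := by
  have e : (fun s => c • (X s : MvPowerSeries σ R)) = (fun _ : σ => c) • (X : σ → MvPowerSeries σ R) := by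
    funext s; rfl
  rw [e, ← MvPowerSeries.rescale_eq_subst, MvPowerSeries.coeff_rescale]
  congr 1
  rw [Finsupp.prod, Finset.prod_pow_eq_pow_sum, degree_apply]

/-- **Bootstrap.**  `G ≡ 0 (mod deg 2)`, arguments `w_s ≡ c·X_s (mod deg 2)` without constant term, `c^i − c` a unit for
`i ≥ 2`, and `c·G ≡ G(w) (mod deg k+1)`; then `G ≡ 0 (mod deg k+1)`.  (Induction on the order `i`: the degree-`i` parts
satisfy `c·G_i = c^i·G_i`.) [cite: Drinfeld1974, §1 Prop. 1.2 (proof)] -/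
theorem le_order_of_smul_sub_subst {σ : Type} [Fintype σ] [Nonempty σ] {c : R} (hc : ∀ i : ℕ, 2 ≤ i → IsUnit (c ^ i - c))
    {k : ℕ} {G : MvPowerSeries σ R} (hG : ((2 : ℕ) : ℕ∞) ≤ G.order) {w : σ → MvPowerSeries σ R}
    (hw0 : ∀ s, MvPowerSeries.constantCoeff (w s) = 0) (hw : ∀ s, ((2 : ℕ) : ℕ∞) ≤ (w s - c • X s).order)
    (h : ((k + 1 : ℕ) : ℕ∞) ≤ (c • G - G.subst w).order) : ((k + 1 : ℕ) : ℕ∞) ≤ G.order := by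
  -- `∀ i, 2 ≤ i → i ≤ k + 1 → ↑i ≤ G.order`
  suffices H : ∀ n : ℕ, ((min (2 + n) (k + 1) : ℕ) : ℕ∞) ≤ G.order by
    have := H (k + 1); rwa [min_eq_right (by omega)] at this
  intro n
  induction n with
  | zero => exact natCast_le_order_of_le hG (by omega)
  | succ n ih =>
    by_cases hlt : 2 + n < k + 1
    · rw [min_eq_left (by omega)] at ih
      rw [show min (2 + (n + 1)) (k + 1) = (2 + n) + 1 by omega]
      refine natCast_succ_le_order' ih fun d hd => ?_
      -- compare the degree-`(2+n)` coefficients of `c·G` and `G(w) ≡ G(cX)`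
      have hcX : ∀ s, MvPowerSeries.constantCoeff (c • (X s : MvPowerSeries σ R)) = 0 := fun s => by simp
      have h1 : ((2 + n + 1 : ℕ) : ℕ∞) ≤ (G.subst w - G.subst (fun s => c • (X s : MvPowerSeries σ R))).order := by
        have := le_order_subst_sub_subst (by omega : 1 ≤ 2 + n) (by norm_num : 1 ≤ 2) ih hw0 hcX hw
        exact natCast_le_order_of_le this (by omega)
      have h2 : ((2 + n + 1 : ℕ) : ℕ∞) ≤ (c • G - G.subst (fun s => c • (X s : MvPowerSeries σ R))).order :=
        natCast_le_order_sub_trans (natCast_le_order_of_le h (by omega)) h1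
      have h3 := (natCast_le_order_sub_iff.1 h2) d (by omega)
      rw [MvPowerSeries.coeff_smul, coeff_subst_smul_X, hd] at h3
      -- h3 : c * coeff d G = c ^ (2+n) * coeff d G
      obtain ⟨u, hu⟩ := hc (2 + n) (by omega)
      have h4 : (c ^ (2 + n) - c) * coeff d G = 0 := by rw [sub_mul, ← h3, sub_self]
      rw [← hu] at h4
      exact (Units.mul_right_eq_zero u).1 h4
    · rw [show min (2 + (n + 1)) (k + 1) = min (2 + n) (k + 1) by omega]; exact ih
where
  /-- `↑(N+1) ≤ G.order` from `↑N ≤ G.order` and vanishing degree-`N` coefficients. -/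
  natCast_succ_le_order' {σ : Type} {N : ℕ} {G : MvPowerSeries σ R} (hG : (N : ℕ∞) ≤ G.order)
      (h : ∀ d : σ →₀ ℕ, d.degree = N → coeff d G = 0) : ((N + 1 : ℕ) : ℕ∞) ≤ G.order := by
    rw [natCast_le_order_iff] at hG ⊢
    intro d hd
    rcases Nat.lt_or_ge d.degree N with hlt | hge
    · exact hG d hlt
    · exact h d (by omega)

/-! ## §2 The linearising series -/

section Linearizer

variable {k : ℕ} {f : MvPowerSeries (Fin 2) R} {r : 𝒪 → PowerSeries R}

/-- `(c·X)^n = c^n · X^n` has `[X^n] = c^n` and the congruence `u^n ≡ (cX)^n (mod deg n+1)` for `u ≡ cX (mod deg 2)`. [folklore] -/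
private theorem le_order_pow_sub_smul_X_pow {u : PowerSeries R} (hu : PowerSeries.constantCoeff u = 0) {c : R}
    (h : ((2 : ℕ) : ℕ∞) ≤ MvPowerSeries.order (u - c • PowerSeries.X)) (n : ℕ) (hn : 1 ≤ n) :
    ((n + 1 : ℕ) : ℕ∞) ≤ MvPowerSeries.order (u ^ n - c ^ n • (PowerSeries.X : PowerSeries R) ^ n) := by
  have hcX : MvPowerSeries.constantCoeff (c • (PowerSeries.X : PowerSeries R)) = 0 := by
    change PowerSeries.constantCoeff (c • PowerSeries.X) = 0; simp
  have := le_order_pow_sub_pow (N := 2) (x := (u : MvPowerSeries Unit R)) (x' := c • (PowerSeries.X : PowerSeries R)) hu hcX h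
    n hn
  rw [smul_pow] at this
  exact natCast_le_order_of_le this (by omega)

/-- **The linearising series.**  For a `k`-bud `(f, r)` (`k ≥ 1`) over `R` with `c = ϖ·1_R` and `c^i − c ∈ R×` (`i ≥ 2`),
there is a strict series `h` (`h(0) = 0`, `[X]h = 1`) with `h(r_ϖ(X)) ≡ c·h(X) (mod deg k+1)`.
[cite: Drinfeld1974, §1 Prop. 1.2 (proof)] [cite: Hazewinkel1978, §21.5] -/
theorem IsOModuleBud.exists_linearizer (h : IsOModuleBud 𝒪 k f r) (hk : 1 ≤ k) (ϖ : 𝒪)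
    (hc : ∀ i : ℕ, 2 ≤ i → IsUnit (algebraMap 𝒪 R ϖ ^ i - algebraMap 𝒪 R ϖ)) :
    ∃ hs : PowerSeries R, PowerSeries.constantCoeff hs = 0 ∧ PowerSeries.coeff 1 hs = 1 ∧
      ((k + 1 : ℕ) : ℕ∞) ≤ MvPowerSeries.order (PowerSeries.subst (r ϖ) hs - algebraMap 𝒪 R ϖ • hs) := by
  set c := algebraMap 𝒪 R ϖ with hcdef
  have hrs : PowerSeries.HasSubst (r ϖ) := h.hasSubst_ρ ϖ
  -- induction on the precision `i`, `1 ≤ i ≤ k`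
  suffices H : ∀ n : ℕ, ∃ hs : PowerSeries R, PowerSeries.constantCoeff hs = 0 ∧ PowerSeries.coeff 1 hs = 1 ∧
      ((min (1 + n) k + 1 : ℕ) : ℕ∞) ≤ MvPowerSeries.order (PowerSeries.subst (r ϖ) hs - c • hs) by
    obtain ⟨hs, h0, h1, hord⟩ := H k
    exact ⟨hs, h0, h1, by rwa [min_eq_right (by omega)] at hord⟩
  intro n
  induction n with
  | zero =>
    refine ⟨PowerSeries.X, PowerSeries.constantCoeff_X, PowerSeries.coeff_one_X, ?_⟩
    rw [min_eq_left hk, PowerSeries.subst_X hrs]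
    exact h.two_le_order_ρ ϖ
  | succ n ih =>
    obtain ⟨hs, h0, h1, hord⟩ := ih
    by_cases hlt : 1 + n < k
    · rw [min_eq_left hlt.le] at hord
      set i := 1 + n with hi
      -- correct the degree-`(i+1)` coefficient
      set e := PowerSeries.coeff (i + 1) (PowerSeries.subst (r ϖ) hs - c • hs) with he
      obtain ⟨u, hu⟩ := hc (i + 1) (by omega)
      set t : R := -(e * ↑u⁻¹) with ht
      refine ⟨hs + t • PowerSeries.X ^ (i + 1), ?_, ?_, ?_⟩
      · simp [h0, zero_pow (by omega : i + 1 ≠ 0)]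
      · have hi1 : i ≠ 0 := by omega
        simp [h1, PowerSeries.coeff_X_pow, hi1]
      · rw [show min (1 + (n + 1)) k + 1 = (i + 1) + 1 by omega]
        have hexp : PowerSeries.subst (r ϖ) (hs + t • PowerSeries.X ^ (i + 1)) - c • (hs + t • PowerSeries.X ^ (i + 1)) =
            (PowerSeries.subst (r ϖ) hs - c • hs) + t • (r ϖ ^ (i + 1) - c ^ (i + 1) • PowerSeries.X ^ (i + 1))
              + (t * (c ^ (i + 1) - c)) • PowerSeries.X ^ (i + 1) := by
          rw [PowerSeries.subst_add hrs, PowerSeries.subst_smul hrs, PowerSeries.subst_pow hrs, PowerSeries.subst_X hrs]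
          simp only [PowerSeries.smul_eq_C_mul, map_mul, map_sub, map_pow]
          ring
        rw [hexp]
        refine le_order_of_smul_sub_subst.natCast_succ_le_order' ?_ fun d hd => ?_
        · refine natCast_le_order_add (natCast_le_order_add hord ?_) ?_
          · exact le_trans (natCast_le_order_of_le (le_order_pow_sub_smul_X_pow (h.constantCoeff_ρ ϖ) (h.two_le_order_ρ ϖ)
              (i + 1) (by omega)) le_rfl |> fun h' => natCast_le_order_of_le h' (by omega)) MvPowerSeries.le_order_smul
          · exact le_trans (natCast_le_order_pow (by change PowerSeries.constantCoeff PowerSeries.X = 0; simp) _)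
              MvPowerSeries.le_order_smul
        · have hd1 : d = single () (i + 1) := by
            rw [degree_eq_sum, Fintype.sum_unique] at hd
            exact Finsupp.ext fun v => by obtain ⟨⟩ := v; simpa using hd
          have hmid : PowerSeries.coeff (i + 1) (r ϖ ^ (i + 1) - c ^ (i + 1) • (PowerSeries.X : PowerSeries R) ^ (i + 1)) = 0 := by
            rw [PowerSeries.coeff_def (s := single () (i + 1)) (n := i + 1) (by simp)]
            exact coeff_of_lt_order_nat (le_order_pow_sub_smul_X_pow (h.constantCoeff_ρ ϖ) (h.two_le_order_ρ ϖ) (i + 1)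
              (by omega)) (by simp)
          rw [hd1, ← PowerSeries.coeff_def (s := single () (i + 1)) (n := i + 1) (by simp), map_add, map_add, ← he,
            map_smul, hmid, smul_zero, add_zero, map_smul, PowerSeries.coeff_X_pow_self, smul_eq_mul, mul_one, ht, ← hu,
            neg_mul, Units.inv_mul_cancel_right, add_neg_cancel]
    · rw [show min (1 + (n + 1)) k = min (1 + n) k by omega]
      exact ⟨hs, h0, h1, hord⟩
where
  /-- a coefficient below the order vanishes (degree form). -/
  coeff_of_lt_order_nat {N : ℕ} {G : PowerSeries R} (hG : (N : ℕ∞) ≤ MvPowerSeries.order G) {d : Unit →₀ ℕ}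
      (hd : d.degree < N) : MvPowerSeries.coeff d G = 0 :=
    (natCast_le_order_iff.1 hG) d hd

/-- For a strict series `hs` and `u` without constant term, `hs(u) ≡ u (mod deg 2)`. [folklore] -/
private theorem two_le_order_psubst_sub_self {hs : PowerSeries R} (h0 : PowerSeries.constantCoeff hs = 0)
    (h1 : PowerSeries.coeff 1 hs = 1) {τ : Type*} {u : MvPowerSeries τ R} (hu : MvPowerSeries.constantCoeff u = 0) :
    ((2 : ℕ) : ℕ∞) ≤ (PowerSeries.subst u hs - u).order := by
  have h := le_order_psubst_sub_psubst_sub h0 h1 le_rfl hu MvPowerSeries.constantCoeff_zero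
    (by simpa using one_le_order_of_constantCoeff hu)
  rwa [PowerSeries.subst_zero_of_constantCoeff_zero h0, sub_zero, sub_zero] at h

/-- **Linearisation of the law.**  With `h` as in `exists_linearizer`: `h(f(X₀,X₁)) ≡ h(X₀) + h(X₁) (mod deg k+1)`.
[cite: Drinfeld1974, §1 Prop. 1.2 (proof)] [cite: Hazewinkel1978, §21.5] -/
theorem IsOModuleBud.le_order_linearizer_law (h : IsOModuleBud 𝒪 k f r) {ϖ : 𝒪}
    (hc : ∀ i : ℕ, 2 ≤ i → IsUnit (algebraMap 𝒪 R ϖ ^ i - algebraMap 𝒪 R ϖ)) {hs : PowerSeries R}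
    (h0 : PowerSeries.constantCoeff hs = 0) (h1 : PowerSeries.coeff 1 hs = 1)
    (hlin : ((k + 1 : ℕ) : ℕ∞) ≤ MvPowerSeries.order (PowerSeries.subst (r ϖ) hs - algebraMap 𝒪 R ϖ • hs)) :
    ((k + 1 : ℕ) : ℕ∞) ≤ (PowerSeries.subst f hs - PowerSeries.subst (X 0 : MvPowerSeries (Fin 2) R) hs -
      PowerSeries.subst (X 1 : MvPowerSeries (Fin 2) R) hs).order := by
  set c := algebraMap 𝒪 R ϖ with hcdef
  set E := PowerSeries.subst f hs - PowerSeries.subst (X 0 : MvPowerSeries (Fin 2) R) hs -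
    PowerSeries.subst (X 1 : MvPowerSeries (Fin 2) R) hs with hE
  have hX : ∀ s : Fin 2, MvPowerSeries.constantCoeff (X s : MvPowerSeries (Fin 2) R) = 0 := fun s =>
    MvPowerSeries.constantCoeff_X s
  have hrs : PowerSeries.HasSubst (r ϖ) := h.hasSubst_ρ ϖ
  have hfs : PowerSeries.HasSubst f := h.hasSubst_F
  -- the arguments `w_s = r_ϖ(X_s)`
  set w : Fin 2 → MvPowerSeries (Fin 2) R := fun s => PowerSeries.subst (X s : MvPowerSeries (Fin 2) R) (r ϖ) with hw
  have hw0 : ∀ s, MvPowerSeries.constantCoeff (w s) = 0 := fun s => PowerSeries.constantCoeff_subst_eq_zero (hX s) _ (h.constantCoeff_ρ ϖ)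
  have hws : HasSubst w := MvPowerSeries.hasSubst_of_constantCoeff_zero hw0
  have hwlin : ∀ s, ((2 : ℕ) : ℕ∞) ≤ (w s - c • X s).order := fun s => by
    have e : w s - c • X s = PowerSeries.subst (X s : MvPowerSeries (Fin 2) R) (r ϖ - c • PowerSeries.X) := by
      rw [PowerSeries.subst_sub (PowerSeries.HasSubst.X s), PowerSeries.subst_smul (PowerSeries.HasSubst.X s),
        PowerSeries.subst_X (PowerSeries.HasSubst.X s)]
    rw [e]; exact le_order_psubst_of_le (h.two_le_order_ρ ϖ) (hX s)
  -- `E ≡ 0 (mod deg 2)`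
  have hE2 : ((2 : ℕ) : ℕ∞) ≤ E.order := by
    have e : E = (PowerSeries.subst f hs - f) + (f - X 0 - X 1) - (PowerSeries.subst (X 0 : MvPowerSeries (Fin 2) R) hs - X 0)
        - (PowerSeries.subst (X 1 : MvPowerSeries (Fin 2) R) hs - X 1) := by rw [hE]; ring
    rw [e]
    exact natCast_le_order_sub (natCast_le_order_sub (natCast_le_order_add (two_le_order_psubst_sub_self h0 h1 h.constantCoeff_F)
      h.two_le_order_F) (two_le_order_psubst_sub_self h0 h1 (hX 0))) (two_le_order_psubst_sub_self h0 h1 (hX 1))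
  refine le_order_of_smul_sub_subst (σ := Fin 2) hc hE2 hw0 hwlin ?_
  -- A1: `hs(r_ϖ(f)) ≡ c·hs(f)`
  have A1 : ((k + 1 : ℕ) : ℕ∞) ≤ (PowerSeries.subst (PowerSeries.subst f (r ϖ)) hs - c • PowerSeries.subst f hs).order := by
    have e : PowerSeries.subst (PowerSeries.subst f (r ϖ)) hs - c • PowerSeries.subst f hs =
        PowerSeries.subst f (PowerSeries.subst (r ϖ) hs - c • hs) := by
      rw [PowerSeries.subst_sub hfs, PowerSeries.subst_smul hfs, PowerSeries.subst_comp_subst_apply hrs hfs]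
    rw [e]; exact le_order_psubst_of_le hlin h.constantCoeff_F
  -- A2: `hs(r_ϖ(f)) ≡ hs(f(w))` from the homomorphism axiom
  have A2 : ((k + 1 : ℕ) : ℕ∞) ≤ (PowerSeries.subst (PowerSeries.subst f (r ϖ)) hs - PowerSeries.subst (f.subst w) hs).order := by
    refine le_order_psubst_sub_psubst' hs (PowerSeries.constantCoeff_subst_eq_zero h.constantCoeff_F _ (h.constantCoeff_ρ ϖ))
      (MvPowerSeries.constantCoeff_subst_eq_zero hws hw0 h.constantCoeff_F) ?_
    have hvec : (![PowerSeries.subst (X 0 : MvPowerSeries (Fin 2) R) (r ϖ), PowerSeries.subst (X 1) (r ϖ)] :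
        Fin 2 → MvPowerSeries (Fin 2) R) = w := by
      funext s; fin_cases s <;> rfl
    have := h.hom ϖ
    rwa [homDefect, hvec] at this
  -- A3: `hs(f(w)) = E(w) + hs(w₀) + hs(w₁)`
  have A3 : PowerSeries.subst (f.subst w) hs = E.subst w + PowerSeries.subst (w 0) hs + PowerSeries.subst (w 1) hs := by
    rw [hE, MvPowerSeries.subst_sub hws, MvPowerSeries.subst_sub hws, subst_powerSeries_subst hfs hws,
      subst_powerSeries_subst (PowerSeries.HasSubst.X 0) hws, subst_powerSeries_subst (PowerSeries.HasSubst.X 1) hws,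
      MvPowerSeries.subst_X hws, MvPowerSeries.subst_X hws]
    ring
  -- A4: `hs(w_s) ≡ c·hs(X_s)`
  have A4 : ∀ s : Fin 2, ((k + 1 : ℕ) : ℕ∞) ≤
      (PowerSeries.subst (w s) hs - c • PowerSeries.subst (X s : MvPowerSeries (Fin 2) R) hs).order := fun s => by
    have e : PowerSeries.subst (w s) hs - c • PowerSeries.subst (X s : MvPowerSeries (Fin 2) R) hs =
        PowerSeries.subst (X s : MvPowerSeries (Fin 2) R) (PowerSeries.subst (r ϖ) hs - c • hs) := by
      rw [PowerSeries.subst_sub (PowerSeries.HasSubst.X s), PowerSeries.subst_smul (PowerSeries.HasSubst.X s),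
        PowerSeries.subst_comp_subst_apply hrs (PowerSeries.HasSubst.X s)]
    rw [e]; exact le_order_psubst_of_le hlin (hX s)
  have e : c • E - E.subst w = -(PowerSeries.subst (PowerSeries.subst f (r ϖ)) hs - c • PowerSeries.subst f hs)
      + (PowerSeries.subst (PowerSeries.subst f (r ϖ)) hs - PowerSeries.subst (f.subst w) hs)
      + (PowerSeries.subst (w 0) hs - c • PowerSeries.subst (X 0 : MvPowerSeries (Fin 2) R) hs)
      + (PowerSeries.subst (w 1) hs - c • PowerSeries.subst (X 1 : MvPowerSeries (Fin 2) R) hs) := by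
    rw [A3, hE, smul_sub, smul_sub]; ring
  rw [e]
  refine natCast_le_order_add (natCast_le_order_add (natCast_le_order_add ?_ A2) (A4 0)) (A4 1)
  rwa [MvPowerSeries.order_neg]

/-- **Linearisation of the action.**  With `h` as in `exists_linearizer`: `h(r_a(X)) ≡ a·h(X) (mod deg k+1)` for every `a`.
[cite: Drinfeld1974, §1 Prop. 1.2 (proof)] [cite: Hazewinkel1978, §21.5] -/
theorem IsOModuleBud.le_order_linearizer_act (h : IsOModuleBud 𝒪 k f r) {ϖ : 𝒪}
    (hc : ∀ i : ℕ, 2 ≤ i → IsUnit (algebraMap 𝒪 R ϖ ^ i - algebraMap 𝒪 R ϖ)) {hs : PowerSeries R}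
    (h0 : PowerSeries.constantCoeff hs = 0) (h1 : PowerSeries.coeff 1 hs = 1)
    (hlin : ((k + 1 : ℕ) : ℕ∞) ≤ MvPowerSeries.order (PowerSeries.subst (r ϖ) hs - algebraMap 𝒪 R ϖ • hs)) (a : 𝒪) :
    ((k + 1 : ℕ) : ℕ∞) ≤ MvPowerSeries.order (PowerSeries.subst (r a) hs - algebraMap 𝒪 R a • hs) := by
  set c := algebraMap 𝒪 R ϖ with hcdef
  set ca := algebraMap 𝒪 R a with hcadef
  set L : PowerSeries R := PowerSeries.subst (r a) hs - ca • hs with hL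
  have hra : PowerSeries.HasSubst (r a) := h.hasSubst_ρ a
  have hrϖ : PowerSeries.HasSubst (r ϖ) := h.hasSubst_ρ ϖ
  have hra0 : MvPowerSeries.constantCoeff (r a : MvPowerSeries Unit R) = 0 := h.constantCoeff_ρ a
  have hrϖ0 : MvPowerSeries.constantCoeff (r ϖ : MvPowerSeries Unit R) = 0 := h.constantCoeff_ρ ϖ
  -- `L ≡ 0 (mod deg 2)`
  have hL2 : ((2 : ℕ) : ℕ∞) ≤ MvPowerSeries.order L := by
    have e : L = (PowerSeries.subst (r a) hs - r a) + (r a - ca • PowerSeries.X) - ca • (hs - PowerSeries.X) := by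
      rw [hL, smul_sub]; ring
    rw [e]
    refine natCast_le_order_sub (natCast_le_order_add (two_le_order_psubst_sub_self h0 h1 hra0) (h.two_le_order_ρ a))
      (le_trans ?_ MvPowerSeries.le_order_smul)
    refine natCast_le_order_of_coeff_eq_zero fun i hi => ?_
    have hi' : i = 0 ∨ i = 1 := by omega
    rcases hi' with rfl | rfl
    · simp [h0]
    · simp [h1]
  -- bootstrap in one variable, `w = r_ϖ`
  have hw0 : ∀ s : Unit, MvPowerSeries.constantCoeff ((fun _ => (r ϖ : MvPowerSeries Unit R)) s) = 0 := fun _ => hrϖ0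
  refine le_order_of_smul_sub_subst (σ := Unit) (w := fun _ => (r ϖ : MvPowerSeries Unit R)) hc hL2 hw0
    (fun s => by obtain ⟨⟩ := s; convert h.two_le_order_ρ ϖ using 2; rfl) ?_
  rw [← PowerSeries.subst_def]
  -- B1: `hs(r_a(r_ϖ)) ≡ hs(r_ϖ(r_a))`
  have B1 : ((k + 1 : ℕ) : ℕ∞) ≤ MvPowerSeries.order (PowerSeries.subst (PowerSeries.subst (r ϖ) (r a)) hs -
      PowerSeries.subst (PowerSeries.subst (r a) (r ϖ)) hs) := by
    refine le_order_psubst_sub_psubst' hs (PowerSeries.constantCoeff_subst_eq_zero hrϖ0 _ (h.constantCoeff_ρ a))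
      (PowerSeries.constantCoeff_subst_eq_zero hra0 _ (h.constantCoeff_ρ ϖ)) ?_
    have h1' := h.mul a ϖ
    have h2' := h.mul ϖ a
    rw [mulDefect] at h1' h2'
    rw [mul_comm ϖ a] at h2'
    have := natCast_le_order_sub h2' h1'
    rwa [sub_sub_sub_cancel_left] at this
  -- B2: `hs(r_ϖ(r_a)) ≡ c·hs(r_a)`
  have B2 : ((k + 1 : ℕ) : ℕ∞) ≤ MvPowerSeries.order (PowerSeries.subst (PowerSeries.subst (r a) (r ϖ)) hs -
      c • PowerSeries.subst (r a) hs) := by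
    have e : PowerSeries.subst (PowerSeries.subst (r a) (r ϖ)) hs - c • PowerSeries.subst (r a) hs =
        PowerSeries.subst (r a) (PowerSeries.subst (r ϖ) hs - c • hs) := by
      rw [PowerSeries.subst_sub hra, PowerSeries.subst_smul hra, PowerSeries.subst_comp_subst_apply hrϖ hra]
    rw [e]; exact le_order_psubst_of_le hlin hra0
  -- B3: `c_a·hs(r_ϖ) ≡ c_a·c·hs`
  have B3 : ((k + 1 : ℕ) : ℕ∞) ≤ MvPowerSeries.order (ca • (PowerSeries.subst (r ϖ) hs - c • hs)) :=
    le_trans hlin MvPowerSeries.le_order_smul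
  have e : c • L - PowerSeries.subst (r ϖ) L =
      -(PowerSeries.subst (PowerSeries.subst (r ϖ) (r a)) hs - PowerSeries.subst (PowerSeries.subst (r a) (r ϖ)) hs)
      - (PowerSeries.subst (PowerSeries.subst (r a) (r ϖ)) hs - c • PowerSeries.subst (r a) hs)
      + ca • (PowerSeries.subst (r ϖ) hs - c • hs) := by
    rw [hL, PowerSeries.subst_sub hrϖ, PowerSeries.subst_smul hrϖ, PowerSeries.subst_comp_subst_apply hra hrϖ, smul_sub,
      smul_sub, smul_smul, smul_smul, mul_comm ca c]
    ring
  rw [e]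
  refine natCast_le_order_add (natCast_le_order_sub ?_ B2) B3
  rwa [MvPowerSeries.order_neg]

end Linearizer

end Literature.RingTheory.FormalGroups
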